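import Summits.CriticalPhenomena.CardyFormulaZ2.Theses.CardySegmentWeakRSW
import Summits.CriticalPhenomena.CardyFormulaZ2.Theses.CardySelfDualSegment
import Summits.CriticalPhenomena.CardyFormulaZ2.Theorems.CardySelfDualSegmentSmirnovBasePoint
import Summits.CriticalPhenomena.CardyFormulaZ2.Theorems.CardySelfDualSegmentQuarterTurnPinning
import Summits.CriticalPhenomena.CardyFormulaZ2.Theorems.CardyIKTransportCrudeToCanonical
import Summits.CriticalPhenomena.CardyFormulaZ2.Theorems.CardySegmentWeakRSWClosedOfWeakBoxCrossingSpecialises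
import HarnessLib

/-!
# Route `CardySegmentWeakRSW`, rung `ClosedOfWeakBoxCrossing` (stmt-CriticalPhenomena-18421):
  position of the rung between the summit `CardyFormulaZ2` and segment universality

The forward rung `ClosedOfWeakBoxCrossing` (`WeakBoxCrossing → UniformMarginality → IsClosed G`,
`G = {t ∈ [0,1] | ∃ α, 0 < im α ∧ CardyMod t α}` the Cardy-good set of the self-dual corner family
`M_t`) is NOT a consequence of the sub-problem statement `S = CardyFormulaZ2`: `S` is a statement about
the single model `M_1 = P_{1/2}` bond percolation on `ℤ²` (the `t = 1` end of the segment, modulo the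
crude/canonical discretisation bridge), while the rung quantifies over every corner model `M_t`,
`t ∈ [0,1]`. This file pins the rung's exact position in the tree's vocabulary:

* `closedOfWeakBoxCrossing_of_target` — the rung IS a consequence of SEGMENT UNIVERSALITY
  `CardySelfDualSegment.Target` (stmt-CriticalPhenomena-5470, open: every `M_t` is Cardy-good after some
  shear, i.e. `G = [0,1]`): the whole interval is closed. So the rung is on the path of the statement the
  continuity method must establish (`Target`), of which `S` is the endpoint.
* `cardyFormulaZ2_of_target` — `Target → CardyFormulaZ2` (read `Target` at `t = 1`; endpoint pinning
  `quarterTurnPinning_proof`, stmt-5475, proved; global discretisation bridge `crudeToCanonical_proof`,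
  stmt-4968, proved). Both the rung and the summit hang below `Target`.
* `target_of_closedOfWeakBoxCrossing` / `closedOfWeakBoxCrossing_iff_target` — modulo the route's three
  other cruxes (`WeakBoxCrossing`, `SegmentOpen`, `UniformMarginality`) the rung is EQUIVALENT to
  `Target`: the clopen sweep on `[0,1]` from the base point `0 ∈ G` (`smirnovBasePoint_proof`, stmt-5474,
  proved). This is the rung's analogue of the parent census `segmentOpen_iff_target`.
* `closedOfWeakBoxCrossing_onPath_census` — the three facts together with the rung's specialisation to
  its proved floor `segmentClosed_of_closedOfWeakBoxCrossing` (`…ClosedOfWeakBoxCrossingSpecialises`):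
  `Target ⟹ rung ⟹ floor (proved)` and `Target ⟹ S`, with `rung ⟺ Target` given the sibling cruxes.

Consequently an implication `S → ClosedOfWeakBoxCrossing` would, given the three sibling cruxes, be an
implication `S → Target` (Cardy for bond-`ℤ²` ⟹ linear universality along the whole corner segment),
which is not a cheap step: the forward kernel's `on_path = false` for this birth is structural, not a
missing lemma. No statement of either route is asserted unconditionally. [folklore]

prover-fwd2-land-1-g2-0 (on-path lander, generation 2), 2026-08-18.
-/

noncomputable section

open Set Filter
open scoped Topology

namespace Summit.CriticalPhenomena.CardyFormulaZ2.Theorems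

/-- **Segment universality ⇒ the rung.** If every corner model `M_t`, `t ∈ [0,1]`, is Cardy-good
after some shear (`CardySelfDualSegment.Target`, stmt-CriticalPhenomena-5470), then the good set is all
of `[0,1]`, which is closed; the two hypotheses of the rung (`WeakBoxCrossing`, `UniformMarginality`)
are not used. [folklore] -/
theorem closedOfWeakBoxCrossing_of_target (hT : Theses.CardySelfDualSegment.Target) :
    Theses.CardySegmentWeakRSW.ClosedOfWeakBoxCrossing := by
  intro _ _
  convert isClosed_univ
  exact Set.eq_univ_of_forall fun t => hT t

/-- **Segment universality ⇒ the summit.** `Target` read at the endpoint `t = 1` says that `M_1` is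
Cardy-good after some shear `φ_α`, `im α > 0`; endpoint pinning (`quarterTurnPinning_proof`,
stmt-CriticalPhenomena-5475: the quarter turn of `ℤ²` forces `α = i`) turns this into Cardy's formula
for `P_{1/2}` bond percolation on `ℤ²` in the crude discretisation of every conformal rectangle, and the
global discretisation bridge (`crudeToCanonical_proof`, stmt-CriticalPhenomena-4968) into
`CardyFormulaZ2`. [folklore] -/
theorem cardyFormulaZ2_of_target (hT : Theses.CardySelfDualSegment.Target) : _root_.CardyFormulaZ2 :=
  fun R => crudeToCanonical_proof (quarterTurnPinning_proof (hT 1)) R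

/-- **The rung gives segment universality back, modulo the sibling cruxes.** Assuming
`WeakBoxCrossing`, `SegmentOpen` and `UniformMarginality` (the route's other three cruxes, taken as
hypotheses — none is asserted), the rung `ClosedOfWeakBoxCrossing` makes the good set `G` clopen in
`[0,1]`; it contains the base point `0` (`smirnovBasePoint_proof`, stmt-CriticalPhenomena-5474:
`im ζ = sin(π/3) > 0`), and `[0,1]` is preconnected, so `G = [0,1]`, i.e. `Target`. This is the
continuity sweep of the route's deciding theorem `closes`, stopped one step before the endpoint is read
off. [folklore] -/
theorem target_of_closedOfWeakBoxCrossing (hW : Theses.CardySegmentWeakRSW.WeakBoxCrossing)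
    (hO : Theses.CardySegmentWeakRSW.SegmentOpen) (hM : Theses.CardySegmentWeakRSW.UniformMarginality)
    (hC : Theses.CardySegmentWeakRSW.ClosedOfWeakBoxCrossing) : Theses.CardySelfDualSegment.Target := by
  intro t
  have hGo := hO hM
  have hGc := hC hW hM
  have hclopen : IsClopen _ := ⟨hGc, hGo⟩
  have hz : 0 < Literature.Probability.LatticeModels.triZeta.im := by
    unfold Literature.Probability.LatticeModels.triZeta
    rw [Complex.exp_im]
    have hre : ((Real.pi : ℂ) * Complex.I / 3).re = 0 := by simp
    have him : ((Real.pi : ℂ) * Complex.I / 3).im = Real.pi / 3 := by simp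
    rw [hre, him, Real.exp_zero, one_mul]
    exact Real.sin_pos_of_pos_of_lt_pi (by positivity) (by linarith [Real.pi_pos])
  haveI : PreconnectedSpace unitInterval := Subtype.preconnectedSpace isPreconnected_Icc
  have huniv := hclopen.eq_univ ⟨0, Literature.Probability.LatticeModels.triZeta, hz,
    smirnovBasePoint_proof⟩
  exact (Set.eq_univ_iff_forall.mp huniv) t

/-- **Census: modulo the sibling cruxes the rung is segment universality.** Under `WeakBoxCrossing`,
`SegmentOpen` and `UniformMarginality` (hypotheses, not asserted),
`ClosedOfWeakBoxCrossing ↔ CardySelfDualSegment.Target`. [folklore] -/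
theorem closedOfWeakBoxCrossing_iff_target (hW : Theses.CardySegmentWeakRSW.WeakBoxCrossing)
    (hO : Theses.CardySegmentWeakRSW.SegmentOpen) (hM : Theses.CardySegmentWeakRSW.UniformMarginality) :
    Theses.CardySegmentWeakRSW.ClosedOfWeakBoxCrossing ↔ Theses.CardySelfDualSegment.Target :=
  ⟨target_of_closedOfWeakBoxCrossing hW hO hM, closedOfWeakBoxCrossing_of_target⟩

/-- **On-path census of the rung `ClosedOfWeakBoxCrossing`.** Segment universality (`Target`,
stmt-CriticalPhenomena-5470) implies both the rung and the summit `CardyFormulaZ2`, and the rung implies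
its proved floor `SegmentClosed` (the dial `UniformBoxCrossing ⟹ WeakBoxCrossing`,
`segmentClosed_of_closedOfWeakBoxCrossing`): `Target ⟹ rung ⟹ floor`, `Target ⟹ S`. The rung is a
consequence of the universality statement whose endpoint is `S`, not of `S`. [folklore] -/
theorem closedOfWeakBoxCrossing_onPath_census :
    (Theses.CardySelfDualSegment.Target →
        Theses.CardySegmentWeakRSW.ClosedOfWeakBoxCrossing ∧ _root_.CardyFormulaZ2) ∧
      (Theses.CardySegmentWeakRSW.ClosedOfWeakBoxCrossing →
        Theses.CardySelfDualSegment.SegmentClosed) :=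
  ⟨fun hT => ⟨closedOfWeakBoxCrossing_of_target hT, cardyFormulaZ2_of_target hT⟩,
    segmentClosed_of_closedOfWeakBoxCrossing⟩

end Summit.CriticalPhenomena.CardyFormulaZ2.Theorems

end
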